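import Literature.MathematicalPhysics.QuantumFieldTheory.Balaban1983to89.B9Eq346GradGpDivTorusL2
import Literature.MathematicalPhysics.QuantumFieldTheory.Balaban1983to89.B9Eq346GradGpDivCoordsL2
import Literature.MathematicalPhysics.QuantumFieldTheory.Balaban1983to89.B9PinMembersKLevelV1

/-!
# `Balaban1983to89.B9Eq346GradGpDivAtPinsL2` — T. Bałaban, *Propagators for lattice gauge theories in a background field*, Commun. Math. Phys. **99**
# (1985) 389–434 [Balaban1985BackgroundPropagators] Thm 3.1 (3.46) p. 398, the order-zero entry `∇_UG′(U)∇*_U`: ★★★ **(3.46)₄ AS A BLOCK-`L²` BOUND OF THE N06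
# CERTIFICATE's COORDINATE LETTER `DvcoKH ∘ GcoS(G′) ∘ DvscoKH` (D_U G′(U) D*_U at node00-def-Y's letters, dag-n06-d's κ-fold real coordinates in the trace basis)
# OVER THE INDEX-BOND BLOCK MAP `blkBK bI` — PROVED, member-uniformly, on the (3.35) class** — the one genuinely-`L²` input of dag-n06-w8's Schur road to the
# certificate's `hstepL2` (its schema field `Thm31GpL2Mixed.e4` verbatim)

statement-level skeleton of published theorems with citation tags; proofs where landed; nothing here is a claim about the Yang–Mills mass gap

THE PRINT (p. 398).  (3.46): *«‖h∇_UG′(U)∇\*_Uλ‖ ≤ B₀·e^{−δ₀d(y,y′)}‖h‖‖λ‖ for supp h ⊂ Δ̃(y), y ∈ Λ_j, supp λ ⊂ Δ̃(y′)»* (prefactor `1`: order zero); (3.47): *«|∇_UG′(U)∇\*_Uλ|_{(γ)}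
≤ B₀|λ|_{(γ)}»*; p. 391: the components `A_μ(x) = A(x, x+ηe_μ)`; p. 397: the blocks `𝔅`, the weighted distance `d(y,y′)` of [4] (2.46); [4] (2.51)–(2.54) pp. 232–233, Lemma 2.1
(2.61) p. 234.

WHY THIS FILE (cell context; WIDTH-209 N06 piece 4 = W-e «`hstepL2` in block-L²»; this seat's located INPUT HAND, agreed with the piece's holder dag-n06-w8 on the
pub-ymgap bus 2026-08-28).  dag-n06-w8's `B9PerturbationL2Algebra ∕ …L2Letters` derive the certificate's `hstepL2 : StepL2 (𝔬12 x) 1 (H x) (θ·(Mα₀)) δ U` from the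
displayed sup schemas `h31 h49 hBJ` by the Schur test, plus ONE `L²` schema field `Thm31GpL2Mixed.e4 : BlockBd blk blk (Dv ∘ₗ Gp ∘ₗ Dvs) (B₄·e^{−δ₄d})` read at the pins
`blk := blkBK x.toKIdx (bI x)`, `Gp := GcoS … (GpY …) U`, `Dv ∕ Dvs := DvcoKH ∕ DvscoKH … U`.  The prequel `B9Eq346GradGpDivTorusL2` proved the analytic content
(dag-n06-w1's Agmon estimate at dag-n06-j's multi-scale exponent) as a Hilbert–Schmidt block-to-block bound of def-Y's `gradY U ∘ GpY (parSymY) U ∘ divY U` between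
TORUS blocks of fine bonds; `B9Eq346GradGpDivCoordsL2` supplies the Parseval dictionary and the pulled-back re-blocking engine.  THIS FILE assembles them at the pins:
* `DvcoKH_GcoS_DvscoKH_eq` — the composite model letter IS `(η²·cR39) •` the mixed coordinate model of def-Y's `D_U ∘ G′(U) ∘ D\*_U` (dag-n06-d's functor calculus);
* `blockBd_torus_coordOpKH_gradY_GpY_divY` — the torus-level block bound of that model, kernel `c_f²·√(10(d+1))·e^{δ₀(1+1∕(2L))}·e^{−δ₁d_T}`;
* ★★ `blockBd_DvGcoSDvs_kIdx` — above ONE threshold `M₄` and with CLOSED `B₄, δ₄ > 0` (on `d, ℓ, N`): for every k-level index with `c_f = L^k`, every letter family `cfg`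
  reading a configuration of the (3.35) class (`G ≤ U(N)`, `c·M·α₀·(d+1) ≤ 1∕16`), every level-∕1-faithful `bI`:
  `BlockBd (toB6 (geo9K i) R₀ H₀) (blkBK i bI) (blkBK i bI) (DvcoKH … U₁ ∘ₗ GcoS … (GpY i (parSymY i)) U₁ ∘ₗ DvscoKH … U₁) (B₄·e^{−δ₄·dist})`;
* ★★★ `blockBd_DvGcoSDvs_memberY` — the same at a member `x : MemberY` with the certificate's `bg9Y` class (its first conjunct), `geo9Y`: dag-n06-w8's `Thm31GpL2Mixed.e4`
  at the pins, VERBATIM (generic in `G ≤ U(N)`; the certificate's `G = SU(N)`).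
CONSTANTS (numbers, not adjectives).  `δ₀ = 1∕(4(d+2))` (dag-n06-w1), `δ₁ = δ₀∕(2L)` (dag-n06-j's domination), `δ₄ = ¾δ₁`; `B₄ = max 1 (cR39 (trBasis N)·√(10(d+1))·e^{δ₀(1+1∕(2L))}·
c·e^{(3∕2)δ₁}·√(e^{δ₁∕4}c))` with `c` the (2.61) row-sum constant of `B9Thm314GpFlatMultiLevelTorus.consts_260_261` at the rate `δ₁`; threshold `M₄ = N₂₆₁ + 1`.  The units:
`D_U`, `D\*_U` carry `c_f` each, `GcoS` carries `η²·cR39`, and `c_f·η = 1` at `c_f = L^k` (`cf_mul_etaS_of_hcfk`) — the composite is `cR39` times an order-zero lattice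
operator, member-uniform.  The regime hypotheses are dag-n06-w1's (`0 ≤ c·M·α₀`, `c·M·α₀·(d+1) ≤ 1∕16`); the certificate's `(M, a)`-prefix implies them with
`a ≤ 1∕(16·c35·(d+1))` (the knit's merge).
HONEST SCOPE.  A READING of a proved estimate into the certificate's block-`L²` vocabulary; the analytic input is dag-n06-w1's theorem through the prequel; nothing of
[B9] beyond it asserted; (3.42)∕(3.49)∕(3.117) untouched; count-neutral; N06 NOT discharged; K1⁷ NOT closed; one finite lattice at a time — nothing continuum ∕ OS ∕
mass gap ∕ Clay.  Cell `pub-ymgap` (HUMAN RULING D-0062 ∕ D-0154), Track A node N06 [B9], width seat `pub-ymgap-dag-n06-w7` (g0), 2026-08-28.  NEW file; imports BUILT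
modules only; nothing landed is modified.  Net new unproved facts: 0.
-/

noncomputable section

namespace Literature.MathematicalPhysics.QuantumFieldTheory.Balaban1983to89.B9Eq346GradGpDivAtPinsL2

open Literature.MathematicalPhysics.QuantumFieldTheory.Balaban1983to89
open Node00 B6KLevelCensusIndexV1 B6Geom246MultiLevelBox B6MultiLevelTorusOperator B6GlobalChartV1 B9BackgroundsKLevelV1
  B6Geom246MultiLevelTorus B9Eq346GradGpDivTorusL2 B9Eq346GradGpDivCoordsL2
open Literature.MathematicalPhysics.QuantumFieldTheory.Balaban1983to89.B6Ineq2142KLevelV1 (lvl β)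
open Literature.MathematicalPhysics.QuantumFieldTheory.Balaban1983to89.B9Thm314GpFlatMultiLevelTorus (consts_260_261)
open Literature.MathematicalPhysics.QuantumFieldTheory.Balaban1983to89.B6Lemma21Repaired (Ineq261With)
open Literature.MathematicalPhysics.QuantumFieldTheory.Balaban1983to89.B9GeoNormsKLevelV1 (geo9K)
open Literature.MathematicalPhysics.QuantumFieldTheory.Balaban1983to89.B9GeoLemma21KLevelV1 (one_le_Mh)
open Literature.MathematicalPhysics.QuantumFieldTheory.Balaban1983to89.B9Ineq349SiteComposite (etaS_pos)
open Literature.MathematicalPhysics.QuantumFieldTheory.Balaban1983to89.B9Thm39ReadingCoords (cR39 cR39_nonneg)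
open Literature.MathematicalPhysics.QuantumFieldTheory.Balaban1983to89.B9CoReadingCoords (XBK blkBK)
open Literature.MathematicalPhysics.QuantumFieldTheory.Balaban1983to89.B9CoReadingCoordsH (coordOpKH)
open Literature.MathematicalPhysics.QuantumFieldTheory.Balaban1983to89.B9CoReadingCoordsS (XSK GcoS)
open Literature.MathematicalPhysics.QuantumFieldTheory.Balaban1983to89.B9CoReadingCoordsTranspose (TrIdx trBasis)
open Literature.MathematicalPhysics.QuantumFieldTheory.Balaban1983to89.B9Thm34Ext (toB6)
open Literature.MathematicalPhysics.QuantumFieldTheory.Balaban1983to89.B9SectDL2Decay (bl2 BlockBd)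
open Literature.MathematicalPhysics.QuantumFieldTheory.Balaban1983to89.B9PinMembersKLevelV1 (MemberY geo9Y bg9Y reg335Y_iff)
open Literature.MathematicalPhysics.QuantumFieldTheory.Balaban1983to89.Node00.OpsYSectDCoords (coordOpKH_comp_coordOpKH DvcoKH DvscoKH)
open Literature.MathematicalPhysics.QuantumFieldTheory.Balaban1983to89.Node00.OpsYNablaBridge (cf_mul_etaS_of_hcfk)
open scoped Matrix Matrix.Norms.L2Operator

variable {d ℓ : ℕ} {hd : 1 ≤ d + 1} {hL : Odd (ℓ + 1) ∧ 1 < ℓ + 1} {b₀ b₁ : ℝ}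
/-! ## §3 (3.46)₄ for the certificate's composite letter `DvcoKH ∘ GcoS(G′) ∘ DvscoKH` over `blkBK bI`: every k-level index above one threshold, every member -/

section AtPins

variable (i : KIdx d ℓ hd hL b₀ b₁) {N : ℕ} {G : Subgroup (Matrix (Fin N) (Fin N) ℂ)ˣ}

/-- a non-negative multiple of an operator with a block-L² bound (dag-n06-w3's `B9Letters313AtOneL2.blockBd_smul_of_nonneg`, restated to keep the import closure small).
[cite: Balaban1984PropagatorsII, (2.51) p.232, bookkeeping] -/
theorem blockBd_smul_of_nonneg' {G' : B6.Geometry} {X₁ X₂ : Type} [Fintype X₁] [Fintype X₂] {blk₁ : X₁ → G'.Site} {blk₂ : X₂ → G'.Site}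
    {T : (X₁ → ℝ) →ₗ[ℝ] (X₂ → ℝ)} {K : G'.Site → G'.Site → ℝ} (h : BlockBd (g := G') blk₁ blk₂ T K) {r : ℝ} (hr : 0 ≤ r) :
    BlockBd (g := G') blk₁ blk₂ (r • T) (fun a a' => r * K a a') := by
  intro y' μ hμ v
  rw [LinearMap.smul_apply, B9SectDL2Decay.bl2_smul, abs_of_nonneg hr, mul_assoc]
  exact mul_le_mul_of_nonneg_left (h y' μ hμ v) hr

/-- ★ **THE COMPOSITE MODEL LETTER IS `(η²·cR39) •` THE MIXED COORDINATE MODEL OF def-Y's `D_U ∘ G′(U) ∘ D\*_U`** (dag-n06-d's functor calculus). [cite: Balaban1985BackgroundPropagators, (3.42) p.397, (3.46) p.398, dictionary] -/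
theorem DvcoKH_GcoS_DvscoKH_eq {κ : Type} [Fintype κ] [DecidableEq κ] (b : Module.Basis κ ℝ (Matrix (Fin N) (Fin N) ℂ)) (B : B9.Backgrounds)
    (cfg : B.Cfg → CfgY (Matrix (Fin N) (Fin N) ℂ) i) (O : SiteOpY (Matrix (Fin N) (Fin N) ℂ) i) (U₁ : B.Cfg) :
    DvcoKH i b B cfg U₁ ∘ₗ (GcoS i b B cfg O U₁ ∘ₗ DvscoKH i b B cfg U₁)
      = (etaS i ^ 2 * cR39 b) • coordOpKH b (fun _ : Fin (d + 1) => (gradY i (cfg U₁) ∘ₗ O (cfg U₁) ∘ₗ divY i (cfg U₁)).restrictScalars ℝ) := by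
  rw [DvcoKH, GcoS, DvscoKH, LinearMap.smul_comp, LinearMap.comp_smul, B9CoReadingCoordsH.coordOpK_comp_coordOpKH, coordOpKH_comp_coordOpKH]
  rfl

open Classical in
/-- the torus-level block bound of the mixed coordinate model of `D_U G′(U) D\*_U` from the prequel's HS estimate, kernel `C₁·e^{−δ₁d_T}` with
`C₁ = c_f²·√(10(d+1))·e^{δ₀(1 + 1∕(2L))}`, `δ₁ = δ₀∕(2L)`, `δ₀ = 1∕(4(d+2))`. [cite: Balaban1985BackgroundPropagators, Thm 3.1 (3.46) p.398; Balaban1984PropagatorsII, (2.46) p.231, (2.54) p.233; Agmon1982, Ch.1, Thm 1.5] -/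
theorem blockBd_torus_coordOpKH_gradY_GpY_divY [Nonempty (Fin N)] (hG : G ≤ B7Prop2Explicit.unitaryUnits (Matrix (Fin N) (Fin N) ℂ))
    {U : CfgY (Matrix (Fin N) (Fin N) ℂ) i} {c α₀ : ℝ} (hC0 : 0 ≤ c * (geo9K i).M * α₀) (hC1 : c * (geo9K i).M * α₀ * ((d : ℝ) + 1) ≤ 1 / 16)
    (hreg : (bg9K (Matrix (Fin N) (Fin N) ℂ) G i).Reg335 c α₀ U) :
    BlockBd (g := geomT i.D) (fun p : XBK (TrIdx N) i => blkV1 i.hN i.D p.1) (fun p : XBK (TrIdx N) i => blkV1 i.hN i.D p.1)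
      (coordOpKH (trBasis N) (fun _ : Fin (d + 1) => (gradY i U ∘ₗ GpY i (parSymY i) U ∘ₗ divY i U).restrictScalars ℝ))
      (fun t s => i.cf ^ 2 * Real.sqrt (10 * ((d : ℝ) + 1)) * Real.exp ((1 / (4 * ((d : ℝ) + 2))) * (1 + 1 / (2 * ((ℓ + 1 : ℕ) : ℝ))))
        * Real.exp (-((1 / (4 * ((d : ℝ) + 2))) / (2 * ((ℓ + 1 : ℕ) : ℝ)) * (geomT i.D).dist t s))) := by
  set δ₀ : ℝ := 1 / (4 * ((d : ℝ) + 2)) with hδ₀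
  set L2 : ℝ := 2 * ((ℓ + 1 : ℕ) : ℝ) with hL2
  have hL2pos : 0 < L2 := by rw [hL2]; positivity
  -- the kernel in the prequel's form `c_f²·√(10(d+1))·E⁻¹`
  have hK : BlockBd (g := geomT i.D) (fun p : XBK (TrIdx N) i => blkV1 i.hN i.D p.1) (fun p : XBK (TrIdx N) i => blkV1 i.hN i.D p.1)
      (coordOpKH (trBasis N) (fun _ : Fin (d + 1) => (gradY i U ∘ₗ GpY i (parSymY i) U ∘ₗ divY i U).restrictScalars ℝ))
      (fun t s => i.cf ^ 2 * Real.sqrt (10 * ((d : ℝ) + 1)) * (Real.exp (δ₀ * (((((bondT i.D).dist t s : ℝ)) - 1) / L2 - 1)))⁻¹) := by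
    refine blockBd_fst_coordOpKH_of_hs (fun t s => by positivity) fun Λ t s hΛ => ?_
    have h := hs_block_gradY_GpY_divY_le i hG (U := U) hC0 hC1 hreg s t hΛ
    have hK2 : (i.cf ^ 2 * Real.sqrt (10 * ((d : ℝ) + 1)) * (Real.exp (δ₀ * (((((bondT i.D).dist t s : ℝ)) - 1) / L2 - 1)))⁻¹) ^ 2
        = i.cf ^ 4 * (10 * ((d : ℝ) + 1)) / Real.exp (δ₀ * (((((bondT i.D).dist t s : ℝ)) - 1) / L2 - 1)) ^ 2 := by
      rw [mul_pow, mul_pow, Real.sq_sqrt (by positivity), inv_pow]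
      ring
    rw [hK2]
    convert h using 3
    all_goals rfl
  refine hK.mono fun t s => le_of_eq ?_
  -- `E⁻¹ = e^{δ₀(1 + 1∕(2L))}·e^{−(δ₀∕(2L))·d_T}`
  have hdist : (geomT i.D).dist t s = (((bondT i.D).dist t s : ℝ)) := rfl
  rw [hdist, ← Real.exp_neg, mul_assoc (i.cf ^ 2 * Real.sqrt (10 * ((d : ℝ) + 1))), ← Real.exp_add]
  congr 2
  rw [hL2]
  field_simp
  ring

/-- ★★ **(3.46)₄ FOR THE CERTIFICATE's COMPOSITE LETTER OVER `blkBK bI`, UNIFORMLY ON THE k-LEVEL CENSUS**: there are `M₄, B₄, δ₄ > 0` (on `d, ℓ, N`) such that for every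
index `i` with `M₄ ≤ M` and `c_f = L^k`, every level- and 1-faithful `bI`, every letter family `cfg` reading a configuration of the (3.35) class (`G ≤ U(N)`, `c·M·α₀ ≥ 0`,
`c·M·α₀·(d+1) ≤ 1∕16`) and every `R₀, H₀`:
`BlockBd (toB6 (geo9K i) R₀ H₀) (blkBK bI) (blkBK bI) (DvcoKH … U₁ ∘ₗ GcoS … (GpY i (parSymY i)) U₁ ∘ₗ DvscoKH … U₁) (B₄·e^{−δ₄·dist})` — print's order-zero line
`‖1_{Δ(y)}∇_UG′(U)∇\*_Uλ‖ ≤ B₀e^{−δ₀d(y,y′)}‖λ‖`, PROVED at node00-def-Y's letters in dag-n06-d's coordinates. [cite: Balaban1985BackgroundPropagators, Thm 3.1 (3.46)–(3.47) p.398, (3.35) p.396, p.397; Balaban1984PropagatorsII, (2.46) p.231, (2.51)–(2.54) pp.232–233, Lemma 2.1 (2.61) p.234; Agmon1982, Ch.1, Thm 1.5] -/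
theorem blockBd_DvGcoSDvs_kIdx (d ℓ : ℕ) (hd : 1 ≤ d + 1) (hL : Odd (ℓ + 1) ∧ 1 < ℓ + 1) (b₀ b₁ : ℝ) (N : ℕ) :
    ∃ M₄ B₄ δ₄ : ℝ, 0 < M₄ ∧ 0 < B₄ ∧ 0 < δ₄ ∧
      ∀ (i : KIdx d ℓ hd hL b₀ b₁), M₄ ≤ (geo9K i).M → i.cf = (((ℓ + 1 : ℕ) : ℝ)) ^ i.k →
      ∀ {G : Subgroup (Matrix (Fin N) (Fin N) ℂ)ˣ} (_ : G ≤ B7Prop2Explicit.unitaryUnits (Matrix (Fin N) (Fin N) ℂ)) [Nonempty (Fin N)]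
        (B : B9.Backgrounds) (cfg : B.Cfg → CfgY (Matrix (Fin N) (Fin N) ℂ) i) (U₁ : B.Cfg) {c α₀ : ℝ}
        (_ : 0 ≤ c * (geo9K i).M * α₀) (_ : c * (geo9K i).M * α₀ * ((d : ℝ) + 1) ≤ 1 / 16)
        (_ : (bg9K (Matrix (Fin N) (Fin N) ℂ) G i).Reg335 c α₀ (cfg U₁))
        {bI : FBondY i → IBondY i} (_ : ∀ f : FBondY i, lvl i.hN i.D i.hk (bI f) = (blkV1 i.hN i.D f).1.1)
        (_ : ∀ f : FBondY i, (geomT i.D).dist (β i.hN i.D i.hk (bI f)) (blkV1 i.hN i.D f) ≤ 1) (R₀ : ℝ) (H₀ : Prop) [Fintype (geo9K i).Site],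
        BlockBd (g := toB6 (geo9K i) R₀ H₀) (blkBK (κ := TrIdx N) i bI) (blkBK (κ := TrIdx N) i bI)
          (DvcoKH i (trBasis N) B cfg U₁ ∘ₗ (GcoS i (trBasis N) B cfg (GpY i (parSymY i)) U₁ ∘ₗ DvscoKH i (trBasis N) B cfg U₁))
          (fun a a' => B₄ * Real.exp (-(δ₄ * (geo9K i).dist a a'))) := by
  set δ₀ : ℝ := 1 / (4 * ((d : ℝ) + 2)) with hδ₀
  set δ₁ : ℝ := δ₀ / (2 * ((ℓ + 1 : ℕ) : ℝ)) with hδ₁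
  have hδ₀pos : 0 < δ₀ := by rw [hδ₀]; positivity
  have hδ₁pos : 0 < δ₁ := by rw [hδ₁]; positivity
  obtain ⟨N₁, c, -, hc0, hcon⟩ := consts_260_261 d ℓ hδ₁pos
  set C₀ : ℝ := Real.sqrt (10 * ((d : ℝ) + 1)) * Real.exp (δ₀ * (1 + 1 / (2 * ((ℓ + 1 : ℕ) : ℝ)))) with hC₀
  set B₄ : ℝ := max (cR39 (trBasis N) * C₀ * c * Real.exp (3 / 2 * δ₁) * Real.sqrt (Real.exp (1 / 4 * δ₁) * c)) 1 with hB₄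
  refine ⟨(N₁ : ℝ) + 1, B₄, 3 / 4 * δ₁, by positivity, lt_of_lt_of_le one_pos (le_max_right _ _), by positivity, ?_⟩
  intro i hM hcf G hG _ B cfg U₁ c' α₀ hC0 hC1 hreg bI hlev hβ1 R₀ H₀ _
  -- Lemma 2.1's row sum at the member
  have hLcast : (((ℓ + 1 : ℕ) : ℝ)) = (ℓ : ℝ) + 1 := by push_cast; ring
  have hMdef : (geo9K i).M = (((ℓ + 1 : ℕ) : ℝ)) * (i.Mh : ℝ) := rfl
  have hN : (N₁ : ℝ) + 1 ≤ ((ℓ : ℝ) + 1) * i.Mh := by rw [← hLcast, ← hMdef]; exact hM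
  have hR1 : 1 ≤ i.R := le_trans (by omega) (toKT i).hR
  have hRN : N₁ + 1 ≤ i.R * ((ℓ + 1) * i.Mh) := by
    have h2 : N₁ + 1 ≤ (ℓ + 1) * i.Mh := by exact_mod_cast hN
    calc N₁ + 1 ≤ 1 * ((ℓ + 1) * i.Mh) := by rw [one_mul]; exact h2
      _ ≤ i.R * ((ℓ + 1) * i.Mh) := Nat.mul_le_mul_right _ hR1
  obtain ⟨-, h261⟩ := hcon i.k i.Mh i.R i.P' (one_le_Mh i) (toKT i).hP hRN
  have h261D : Ineq261With c (geomT i.D) δ₁ (1 / 4) := h261 i.D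
  -- the torus bound, re-blocked on `bI ∘ fst`, then scaled by `η²·cR39`
  have hT := blockBd_torus_coordOpKH_gradY_GpY_divY i hG (U := cfg U₁) hC0 hC1 hreg
  have hC₁ : 0 ≤ i.cf ^ 2 * Real.sqrt (10 * ((d : ℝ) + 1)) * Real.exp ((1 / (4 * ((d : ℝ) + 2))) * (1 + 1 / (2 * ((ℓ + 1 : ℕ) : ℝ)))) := by positivity
  have hre := blockBd_pull_bI_of_blockBd_torus i (X := XBK (TrIdx N) i) Prod.fst hlev hβ1 hC₁ hδ₁pos.le hT h261D R₀ H₀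
  have hs0 : 0 ≤ etaS i ^ 2 * cR39 (trBasis N) := mul_nonneg (sq_nonneg _) (cR39_nonneg _)
  have hsm := blockBd_smul_of_nonneg' hre hs0
  rw [← DvcoKH_GcoS_DvscoKH_eq i (trBasis N) B cfg (GpY i (parSymY i)) U₁] at hsm
  refine hsm.mono fun a a' => ?_
  -- constants: `η²·c_f² = 1` at `c_f = L^k`, and the row-sum product is below `B₄`
  have hunit : etaS i ^ 2 * i.cf ^ 2 = 1 := by rw [← mul_pow, mul_comm, cf_mul_etaS_of_hcfk i hcf, one_pow]
  have hle : cR39 (trBasis N) * C₀ * c * Real.exp (3 / 2 * δ₁) * Real.sqrt (Real.exp (1 / 4 * δ₁) * c) ≤ B₄ := le_max_left _ _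
  have hexp0 : 0 ≤ Real.exp (-(3 / 4 * δ₁ * (geo9K i).dist a a')) := (Real.exp_pos _).le
  calc etaS i ^ 2 * cR39 (trBasis N) * (i.cf ^ 2 * Real.sqrt (10 * ((d : ℝ) + 1)) * Real.exp ((1 / (4 * ((d : ℝ) + 2))) * (1 + 1 / (2 * ((ℓ + 1 : ℕ) : ℝ))))
          * c * Real.exp (3 / 2 * δ₁) * Real.sqrt (Real.exp (1 / 4 * δ₁) * c) * Real.exp (-(3 / 4 * δ₁ * (geo9K i).dist a a')))
      = (etaS i ^ 2 * i.cf ^ 2) * (cR39 (trBasis N) * C₀ * c * Real.exp (3 / 2 * δ₁) * Real.sqrt (Real.exp (1 / 4 * δ₁) * c))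
          * Real.exp (-(3 / 4 * δ₁ * (geo9K i).dist a a')) := by rw [hC₀]; ring
    _ ≤ B₄ * Real.exp (-(3 / 4 * δ₁ * (geo9K i).dist a a')) := by
        rw [hunit, one_mul]
        exact mul_le_mul_of_nonneg_right hle hexp0

/-- ★★★ **(3.46)₄ AT A MEMBER OF THE N06 CERTIFICATE — dag-n06-w8's `Thm31GpL2Mixed.e4` AT THE PINS, VERBATIM**: for `x : MemberY` above the threshold, a configuration
`U` of the member regular for `{Ω_j}` and `{Ω′_j}` (`bg9Y`'s (3.35) field; only its first conjunct is used) with `0 ≤ c·M·α₀`, `c·M·α₀·(d+1) ≤ 1∕16`, `G ≤ U(N)`, `N ≥ 1`,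
and the certificate's level-∕1-faithful index-bond block assignment `bI`:
`BlockBd (toB6 (geo9Y x) R₀ H₀) (blkBK x.toKIdx bI) (blkBK x.toKIdx bI) (DvcoKH … U ∘ₗ GcoS … (GpY x.toKIdx (parSymY x.toKIdx)) U ∘ₗ DvscoKH … U) (B₄·e^{−δ₄·(geo9Y x).dist})`.
[cite: Balaban1985BackgroundPropagators, Thm 3.1 (3.46)–(3.47) p.398, (3.35) p.396, p.397; Balaban1984PropagatorsII, (2.46) p.231, (2.51)–(2.54) pp.232–233, Lemma 2.1 (2.61) p.234; Agmon1982, Ch.1, Thm 1.5] -/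
theorem blockBd_DvGcoSDvs_memberY (d ℓ : ℕ) (hd : 1 ≤ d + 1) (hL : Odd (ℓ + 1) ∧ 1 < ℓ + 1) (b₀ b₁ : ℝ) (Mstar : ℕ) (N : ℕ) [NeZero N] :
    ∃ M₄ B₄ δ₄ : ℝ, 0 < M₄ ∧ 0 < B₄ ∧ 0 < δ₄ ∧
      ∀ {G : Subgroup (Matrix (Fin N) (Fin N) ℂ)ˣ} (_ : G ≤ B7Prop2Explicit.unitaryUnits (Matrix (Fin N) (Fin N) ℂ))
        (x : MemberY d ℓ hd hL b₀ b₁ Mstar), M₄ ≤ (geo9Y x).M →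
      ∀ {c : ℝ} (α₀ : ℝ), 0 ≤ c * (geo9Y x).M * α₀ → c * (geo9Y x).M * α₀ * ((d : ℝ) + 1) ≤ 1 / 16 →
      ∀ (U : (bg9Y (Matrix (Fin N) (Fin N) ℂ) G x).Cfg), (bg9Y (Matrix (Fin N) (Fin N) ℂ) G x).Reg335 c α₀ U →
      ∀ {bI : FBondY x.toKIdx → IBondY x.toKIdx} (_ : ∀ f, lvl x.hN x.D x.hk (bI f) = (blkV1 x.hN x.D f).1.1)
        (_ : ∀ f, (geomT x.D).dist (β x.hN x.D x.hk (bI f)) (blkV1 x.hN x.D f) ≤ 1) (R₀ : ℝ) (H₀ : Prop) [Fintype (geo9Y x).Site],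
        BlockBd (g := toB6 (geo9Y x) R₀ H₀) (blkBK (κ := TrIdx N) x.toKIdx bI) (blkBK (κ := TrIdx N) x.toKIdx bI)
          (DvcoKH x.toKIdx (trBasis N) (bg9Y (Matrix (Fin N) (Fin N) ℂ) G x) (fun U => U) U ∘ₗ
            (GcoS x.toKIdx (trBasis N) (bg9Y (Matrix (Fin N) (Fin N) ℂ) G x) (fun U => U) (GpY x.toKIdx (parSymY x.toKIdx)) U ∘ₗ
              DvscoKH x.toKIdx (trBasis N) (bg9Y (Matrix (Fin N) (Fin N) ℂ) G x) (fun U => U) U))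
          (fun a a' => B₄ * Real.exp (-(δ₄ * (geo9Y x).dist a a'))) := by
  obtain ⟨M₄, B₄, δ₄, hM₄, hB₄, hδ₄, H⟩ := blockBd_DvGcoSDvs_kIdx d ℓ hd hL b₀ b₁ N
  refine ⟨M₄, B₄, δ₄, hM₄, hB₄, hδ₄, ?_⟩
  intro G hG x hM c α₀ hC0 hC1 U hU bI hlev hβ1 R₀ H₀ _
  haveI : Nonempty (Fin N) := ⟨⟨0, Nat.pos_of_ne_zero (NeZero.ne N)⟩⟩
  letI : Fintype (geo9K x.toKIdx).Site := (inferInstance : Fintype (geo9Y x).Site)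
  exact H x.toKIdx hM x.hcfk hG (bg9Y (Matrix (Fin N) (Fin N) ℂ) G x) (fun U => U) U hC0 hC1 ((reg335Y_iff x c α₀ U).1 hU).1 hlev hβ1 R₀ H₀

/-- ★★★ **THE SAME IN THE CERTIFICATE's `(M, a)`-REGIME PREFIX** (dag-n06-d's binder shape `M₄ ≤ M_x → ∀ α₀ > 0, M_x·α₀ ≤ a₄ → ∀ U, Reg335 c α₀ U → …`): for a class
constant `c > 0` (the certificate's `c35Y`) the threshold `a₄ := 1∕(16·c·(d+1))` turns the prefix into dag-n06-w1's regime `0 ≤ c·M·α₀`, `c·M·α₀·(d+1) ≤ 1∕16`.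
[cite: Balaban1985BackgroundPropagators, Thm 3.1 (3.46) p.398, (3.35) p.396; Balaban1984PropagatorsII, (2.46) p.231, (2.51)–(2.54) pp.232–233; Agmon1982, Ch.1, Thm 1.5] -/
theorem blockBd_DvGcoSDvs_memberY_regime (d ℓ : ℕ) (hd : 1 ≤ d + 1) (hL : Odd (ℓ + 1) ∧ 1 < ℓ + 1) (b₀ b₁ : ℝ) (Mstar : ℕ) (N : ℕ) [NeZero N] {c : ℝ} (hc : 0 < c) :
    ∃ M₄ a₄ B₄ δ₄ : ℝ, 0 < M₄ ∧ 0 < a₄ ∧ 0 < B₄ ∧ 0 < δ₄ ∧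
      ∀ {G : Subgroup (Matrix (Fin N) (Fin N) ℂ)ˣ} (_ : G ≤ B7Prop2Explicit.unitaryUnits (Matrix (Fin N) (Fin N) ℂ))
        (x : MemberY d ℓ hd hL b₀ b₁ Mstar), M₄ ≤ (geo9Y x).M → ∀ α₀ : ℝ, 0 < α₀ → (geo9Y x).M * α₀ ≤ a₄ →
      ∀ (U : (bg9Y (Matrix (Fin N) (Fin N) ℂ) G x).Cfg), (bg9Y (Matrix (Fin N) (Fin N) ℂ) G x).Reg335 c α₀ U →
      ∀ {bI : FBondY x.toKIdx → IBondY x.toKIdx} (_ : ∀ f, lvl x.hN x.D x.hk (bI f) = (blkV1 x.hN x.D f).1.1)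
        (_ : ∀ f, (geomT x.D).dist (β x.hN x.D x.hk (bI f)) (blkV1 x.hN x.D f) ≤ 1) (R₀ : ℝ) (H₀ : Prop) [Fintype (geo9Y x).Site],
        BlockBd (g := toB6 (geo9Y x) R₀ H₀) (blkBK (κ := TrIdx N) x.toKIdx bI) (blkBK (κ := TrIdx N) x.toKIdx bI)
          (DvcoKH x.toKIdx (trBasis N) (bg9Y (Matrix (Fin N) (Fin N) ℂ) G x) (fun U => U) U ∘ₗ
            (GcoS x.toKIdx (trBasis N) (bg9Y (Matrix (Fin N) (Fin N) ℂ) G x) (fun U => U) (GpY x.toKIdx (parSymY x.toKIdx)) U ∘ₗ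
              DvscoKH x.toKIdx (trBasis N) (bg9Y (Matrix (Fin N) (Fin N) ℂ) G x) (fun U => U) U))
          (fun a a' => B₄ * Real.exp (-(δ₄ * (geo9Y x).dist a a'))) := by
  obtain ⟨M₄, B₄, δ₄, hM₄, hB₄, hδ₄, H⟩ := blockBd_DvGcoSDvs_memberY d ℓ hd hL b₀ b₁ Mstar N
  refine ⟨M₄, 1 / (16 * c * ((d : ℝ) + 1)), B₄, δ₄, hM₄, by positivity, hB₄, hδ₄, ?_⟩
  intro G hG x hM α₀ hα₀ ha U hU bI hlev hβ1 R₀ H₀ _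
  have hM0 : 0 ≤ (geo9Y x).M := le_trans hM₄.le hM
  have hC0 : 0 ≤ c * (geo9Y x).M * α₀ := by positivity
  have hC1 : c * (geo9Y x).M * α₀ * ((d : ℝ) + 1) ≤ 1 / 16 := by
    have hd1 : (0 : ℝ) < (d : ℝ) + 1 := by positivity
    have h1 : c * (geo9Y x).M * α₀ * ((d : ℝ) + 1) = (c * ((d : ℝ) + 1)) * ((geo9Y x).M * α₀) := by ring
    rw [h1]
    calc c * ((d : ℝ) + 1) * ((geo9Y x).M * α₀) ≤ c * ((d : ℝ) + 1) * (1 / (16 * c * ((d : ℝ) + 1))) :=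
          mul_le_mul_of_nonneg_left ha (by positivity)
      _ = 1 / 16 := by field_simp
  exact H hG x hM α₀ hC0 hC1 U hU hlev hβ1 R₀ H₀

end AtPins

end Literature.MathematicalPhysics.QuantumFieldTheory.Balaban1983to89.B9Eq346GradGpDivAtPinsL2

end
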